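import Summits.QuantumFields.BalabanUV.Beta.FP.BlockMeanProjectorGrad
import Summits.QuantumFields.BalabanUV.Beta.GAN24.PsiParentBlockMeans
import Summits.QuantumFields.BalabanUV.Beta.CompositeCorrectorLocality

/-!
# `BalabanUV.Beta.FP.NestedDressingProjector` — road «FP» for binder row D1, PROPOSED RULING R-FP-45 (B), row NESTED-DRESS (definition lane):
# THE NESTED SYMMETRISED BLOCK-MEAN DRESSING OF THE `m`-FOLD COMPOSITE STEP — the gauge functional `σ^{(m+1)} A := σ₁ A + (σ^{(m)} (𝒬̄_{Lc} A)) ∘ blk Lc`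
# (`σ₁ = symBmGaugeAt ρ · Lc` the literal's one-step functional, `𝒬̄_{Lc} = (Lc^d)⁻¹·contourSum Lc` the mean-normalised straight averaging) and the projector
# `Π^{(m)}_nest A := A − grad (σ^{(m)} A)`; LETTERS: `Π^{(1)}_nest = Π^{sym}_bm` (the literal UNCHANGED at m = 1), `Π^{(m)}_nest (grad f) = grad (blockMeanAt (Lc^m) f)`
# (it KILLS every gauge direction of zero `Lc^m`-block means and FIXES the `Lc^m`-block-constant ones), `σ^{(m)}` has zero `Lc^m`-block sums, `Π^{(m)}_nest` is
# IDEMPOTENT and preserves the composite straight averages `contourSum (Lc^m)`, ON `ker 𝒬̄_{Lc}` IT IS THE ONE-STEP PROJECTOR, and it DESCENDS through one averaging: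
# `𝒬̄_{Lc} ∘ Π^{(m+1)}_nest = Π^{(m)}_nest ∘ 𝒬̄_{Lc}`

HONEST DEPENDENCY (page 1, mandatory): continuum YM on T⁴ ⇐ BetaPertH ∧ nine spine estimates (0/9 proved); BetaPertH ⇐ (D1) ∧ (D4) ∧ CAP+tail;
G-an2-4 gates asym, D1 and NE2/3/4.  HONEST FRAMING (cell contract, verbatim): «discharging `BetaPertH` makes Bałaban's UV stability UNCONDITIONAL —
a real constructive-QFT result; it is NOT the continuum limit and NOT the Clay problem.»  THIS MODULE DISCHARGES NOTHING of the wall: [folklore] finite sums on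
`ℤ^d` at the Form level (generic dimension `d`, any root `ρ`, blocking `Lc ≥ 1` where stated).  Plumbing definitions `bmean`, `liftBlk`, `qbar` and the row's
OBJECT `symNestGaugeAt` ∕ `symAxProjNestAt`; no `def … : Prop`, nothing cited, 0 sorry; 0∕4 row-D1 binders; NOT SDF, NOT D1, NOT BetaPertH, NOT continuum, NOT Clay.
«not in print; our bookkeeping» — the composition of renormalization transformations with a gauge fixing at EACH level on that level's own averaged variable
is the subject of [Balaban1987RG1] §1 (1.1)–(1.22) pp. 255–264 (orientation only; nothing quoted is load-bearing).

ABSOLUTE RULE (cell charter, verbatim): «No internally-minted statement may enter as a cited fact. Every hypothesis is either kernel-proved in this package or a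
verbatim quotation of a PUBLISHED theorem with page reference. The manuscript(s) under audit are NOT citable for their own disputed steps — they are the thing
under adjudication; programme-internal (2001/route/tribunal) claims are never citable.»

WHY (owner memo `HOME/b2b-balaban-beta-d1-p3/N2B-DESIGN.md` v2 §9 (9d); OWNER WORDS journal l.33213 (1); the owner's abstract kernel `FP/NestedDressingStepLaw`).
R-FP-41's (j, m)-jet families dress every `m`-fold composite with the ONE-STEP projector `Π̂₁ = symAxProjBmAt ρ Lc`, which kills the gauge directions `dz θ` of
zero `Lc`-block means only (`Π̂₁ (grad θ) = grad (blockMeanAt Lc θ)`, the owner's `FP/BlockMeanProjectorGrad`): on the COARSE gauge modes the composite form's null directions then depend on the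
background and the END's step defect is a linearised Faddeev–Popov quotient (memo §9 (9b)–(9c)).  The owner's abstract `Π_nest := 1 − W(τ̃W)⁻¹τ̃`,
`τ̃ = [S^c·Q₁; S₁]`, kills ALL composite gauge directions and is `Π₁` on `ker Q₁` (`NestedDressingStepLaw.nestedProj_mul_W`, `nestedProj_mul_of_blind`).  THIS FILE
TYPES ITS LATTICE INSTANCE over the literal's own objects: with `S₁ = σ₁`, `Q₁ = 𝒬̄_{Lc}`, `S^c = σ^{(m)}` (the same functional one level up), the block-triangular
system `τ̃·dz|_Θ` is solved in closed form by `σ₁ (dz θ) = θ − blockMeanAt Lc θ` and `𝒬̄ (dz θ) = dz (bmean θ)`, giving the RECURSION of §3, and every letter of the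
row is a finite-sum identity (§4–§6).  The projector does not depend on the normalisation ∕ rooting of the averaging used to STATE the constraint: its kernel is
`dz Θ_{Lc^m}`, its range the nested slice `{σ₁ A = 0, σ^{(m−1)}(𝒬̄ A) = 0}`, and on the fine slice the rooted symmetrised averaging is `d!·contourSum` (an2
`symLinAvgAt_symAxProjBmAt_eq`).

CONTENTS ([folklore]; `hLc : 1 ≤ Lc` where stated): §1 `blk_blk'`, `bmean` (`liftBlk_bmean : (bmean L f) ∘ blk L = blockMeanAt L f`), `liftBlk`, `qbar` (`qbar_dz`,
`qbar_grad`, `qbar_sub ∕ _add ∕ _zero`), `blockSum_liftBlk`, `bmean_liftBlk`, `blockMeanAt_liftBlk`, `blockMeanAt_one`,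
**`liftBlk_blockMeanAt_bmean`** (NESTED MEANS, via gan24-leaf-04's `blockSum_mul`).  §2 (the exact-form identities `symBmGaugeAt_grad` ∕ `symAxProjBmAt_grad`
are IMPORTED from the owner's `FP/BlockMeanProjectorGrad`): `qbar_grad_eq_zero_of_blockSum` (`Q₁W₁ = 0`), `symBmGaugeAt_grad_of_blockSum` (`σ₁∘dz = id` on `Θ_L`),
`symBmGaugeAt_sub ∕ _zero`, `blockSum_symBmGaugeAt`, `bmean_symBmGaugeAt`.  §3 [our object]
`symNestGaugeAt` (`_zero_left`, `_succ`, **`_one`** `= σ₁`), `symAxProjNestAt` (`_zero`, **`symAxProjNestAt_one : Π^{(1)}_nest = symAxProjBmAt ρ Lc`**), `symNestGaugeAt_map_zero ∕ _sub`,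
`symAxProjNestAt_sub`, **`symNestGaugeAt_eq_sum`** (`σ^{(m)} A x = Σ_{k<m} σ₁ (𝒬̄^k A) (blk (Lc^k) x)`).  §4 **`symNestGaugeAt_grad`** (`σ^{(m)} (grad f) = f − blockMeanAt (Lc^m) f`),
**`symAxProjNestAt_grad`**, `symNestGaugeAt_grad_of_blockSum` (`σ^{(m)}∘dz = id` on `Θ_{Lc^m}`), `symAxProjNestAt_grad_eq_zero_of_blockSum` (KILLS `dz Θ_{Lc^m}`),
`symAxProjNestAt_grad_liftBlk` (FIXES block-constant gauges).
§5 **`blockSum_symNestGaugeAt`**, `blockMeanAt_symNestGaugeAt`, `symNestGaugeAt_symAxProjNestAt` (`σ^{(m)} ∘ Π^{(m)} = 0`), **`symAxProjNestAt_idem`**,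
**`contourSum_symAxProjNestAt`**.  §6 **`symAxProjNestAt_succ_of_qbar_eq_zero`** ∕ `_of_contourSum_eq_zero` (on `ker 𝒬_{Lc}`: `Π^{(m+1)}_nest A = Π̂₁ A` — the lattice twin of
`nestedProj_mul_of_blind`), **`qbar_symAxProjNestAt_succ`** (DESCENT), `qbar_iterate_symAxProjNestAt` (`𝒬̄^k ∘ Π^{(m+k)} = Π^{(m)} ∘ 𝒬̄^k`).
NOT HERE (next files of the row): the MATRIX of `Π^{(m)}_nest` with its `Lc^m`-block WINDOW and bound (locality letter; cf. an2 `SymmetrisedDressingMatrix.pmSymBm`),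
the kernelisation and the covariances; the road rows (β-c) and SDF-EXACT (owner).  Provenance: road FP swarm LEAF PROVER `b2b-balaban-beta-d1-formalise-leaf-06`
gen 14, 2026-08-21, row NESTED-DRESS on the owner's assignment (journal l.33213 (1)); names PROVISIONAL — the owner ∕ an2 (dressing author) may rename or re-cut.
-/

namespace Summit.QuantumFields.BalabanUV.Beta.FP.NestedDressingProjector

noncomputable section

open Finset
open scoped BigOperators Nat
open Literature.MathematicalPhysics.QuantumFieldTheory.Balaban1983to89.Beta
open AffineAveraging (Form0 Form1 Site unitVec dz box toSite blockSum contourSum contourSum_dz)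
open AffineReproduction (contourSum_sub contourSum_add dz_sub)
open AveragingContours (grad blk blk_block grad_eq_dz toSite_zero)
open ResolventComposition (box_one)
open AxialProjector (grad_add grad_zero)
open Summit.QuantumFields.BalabanUV.Beta.AxialProjectorBlockMean (blockMeanAt grad_sub blockSum_sub_blockMeanAt)
open Summit.QuantumFields.BalabanUV.Beta.SymmetrisedAxialPotential (symTreeGaugeAt)
open Summit.QuantumFields.BalabanUV.Beta.SymmetrisedAxialGauge (symTreeGaugeAt_sub)
open Summit.QuantumFields.BalabanUV.Beta.SymmetrisedAxialGaugeBlockMean (symGaugeAt symBmGaugeAt symAxProjBmAt)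
open Summit.QuantumFields.BalabanUV.Beta.FP.BlockMeanProjectorGrad (symBmGaugeAt_grad symAxProjBmAt_grad blockMeanAt_sub)
open Summit.QuantumFields.BalabanUV.Beta.GAN24.PsiParentBlockMeans (blockSum_mul blockSum_comp_blk_mul)
open Summit.QuantumFields.BalabanUV.Beta.CompositeCorrectorLocality (blk_one)

variable {d : ℕ}

/-! ## §1 Coarse readings: nested block labels, the coarse block mean, the lift, the mean-normalised straight averaging -/

/-- [folklore] Iterated block labels (generic dimension): `blk M (blk L x) = blk (L·M) x`. -/
theorem blk_blk' (L M : ℕ) (x : Site d) : blk M (blk L x) = blk (L * M) x := by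
  funext i
  simp only [blk]
  push_cast
  exact Int.ediv_ediv_of_nonneg (Int.natCast_nonneg L)

/-- [our object, plumbing] THE BLOCK MEAN READ ON THE COARSE LATTICE: `bmean L f y := (L^d)⁻¹ · Σ_{x ∈ B_L(y)} f x`. -/
def bmean (L : ℕ) (f : Form0 d ℝ) : Form0 d ℝ := fun y => (((L : ℝ) ^ d))⁻¹ * blockSum L f y

/-- [our object, plumbing] THE LIFT of a coarse function to the fine lattice, constant on `L`-blocks: `liftBlk L ψ := ψ ∘ blk L`. -/
def liftBlk (L : ℕ) (ψ : Form0 d ℝ) : Form0 d ℝ := fun x => ψ (blk L x)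

/-- [our object, plumbing] THE MEAN-NORMALISED STRAIGHT BLOCK AVERAGING of 1-forms `𝒬̄_L A := (L^d)⁻¹ · contourSum L A` (the sum of `A` along the straight
contour of `L` bonds, averaged over the `L^d` starting points of the block — [Balaban1984PropagatorsI] (1.11) up to normalisation). -/
def qbar (L : ℕ) (A : Form1 d ℝ) : Form1 d ℝ := fun κ y => (((L : ℝ) ^ d))⁻¹ * contourSum L A κ y

/-- [folklore] The block mean read at a fine point is the lift of the coarse block mean (definitional). -/
theorem liftBlk_bmean (L : ℕ) (f : Form0 d ℝ) : liftBlk L (bmean L f) = blockMeanAt L f := by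
  funext x
  simp only [liftBlk, bmean, blockMeanAt, div_eq_mul_inv, mul_comm]

/-- [folklore] **`𝒬̄ (dz f) = dz (bmean f)`** — averaging intertwines the exterior derivative (`contourSum_dz`), mean-normalised. -/
theorem qbar_dz (L : ℕ) (f : Form0 d ℝ) : qbar L (dz f) = dz (bmean L f) := by
  funext κ y
  simp only [qbar, contourSum_dz, dz, bmean, mul_sub]

/-- [folklore] The same with `grad` (`grad = dz`). -/
theorem qbar_grad (L : ℕ) (f : Form0 d ℝ) : qbar L (grad f) = grad (bmean L f) := by
  rw [grad_eq_dz, qbar_dz, grad_eq_dz]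

/-- [folklore] Linearity of `qbar` (differences). -/
theorem qbar_sub (L : ℕ) (A A' : Form1 d ℝ) : qbar L (A - A') = qbar L A - qbar L A' := by
  funext κ y
  simp only [qbar, contourSum_sub, Pi.sub_apply, mul_sub]

/-- [folklore] Linearity of `qbar` (sums). -/
theorem qbar_add (L : ℕ) (A A' : Form1 d ℝ) : qbar L (A + A') = qbar L A + qbar L A' := by
  funext κ y
  simp only [qbar, contourSum_add, Pi.add_apply, mul_add]

/-- [folklore] `qbar L 0 = 0`. -/
theorem qbar_zero (L : ℕ) : qbar L (0 : Form1 d ℝ) = 0 := by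
  have h := qbar_sub L (0 : Form1 d ℝ) 0
  rwa [sub_self, sub_self] at h

/-- [folklore] Linearity of `liftBlk` (differences). -/
theorem liftBlk_sub (L : ℕ) (ψ ψ' : Form0 d ℝ) : liftBlk L (ψ - ψ') = liftBlk L ψ - liftBlk L ψ' := rfl

/-- [folklore] `liftBlk L 0 = 0`. -/
theorem liftBlk_zero (L : ℕ) : liftBlk L (0 : Form0 d ℝ) = 0 := rfl

/-- [folklore] The block sum of a lifted function: `blockSum L (ψ ∘ blk L) y = L^d · ψ y`. -/
theorem blockSum_liftBlk {L : ℕ} (ψ : Form0 d ℝ) (y : Site d) : blockSum L (liftBlk L ψ) y = ((L : ℝ) ^ d) * ψ y := by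
  have hcard : (box d L).card = L ^ d := by
    simp only [AffineAveraging.box, Fintype.card_piFinset, Finset.card_range, Finset.prod_const, Finset.card_univ, Fintype.card_fin]
  show ∑ b ∈ box d L, ψ (blk L ((L : ℤ) • y + toSite b)) = ((L : ℝ) ^ d) * ψ y
  rw [Finset.sum_congr rfl fun b hb => by rw [blk_block y hb], Finset.sum_const, hcard, nsmul_eq_mul]
  push_cast
  ring

/-- [folklore] **`bmean (ψ ∘ blk) = ψ`** (`L ≥ 1`). -/
theorem bmean_liftBlk {L : ℕ} (hL : 1 ≤ L) (ψ : Form0 d ℝ) : bmean L (liftBlk L ψ) = ψ := by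
  funext y
  have hLd : ((L : ℝ) ^ d) ≠ 0 := pow_ne_zero _ (by exact_mod_cast (show L ≠ 0 by omega))
  rw [bmean, blockSum_liftBlk, ← mul_assoc, inv_mul_cancel₀ hLd, one_mul]

/-- [folklore] A lifted (block-constant) function is its own block mean (`L ≥ 1`). -/
theorem blockMeanAt_liftBlk {L : ℕ} (hL : 1 ≤ L) (ψ : Form0 d ℝ) : blockMeanAt L (liftBlk L ψ) = liftBlk L ψ := by
  rw [← liftBlk_bmean, bmean_liftBlk hL]

/-- [folklore] `blockMeanAt 1 = id`. -/
theorem blockMeanAt_one (f : Form0 d ℝ) : blockMeanAt 1 f = f := by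
  funext x
  simp only [blockMeanAt, AffineAveraging.blockSum, box_one, Finset.sum_singleton, Nat.cast_one, one_pow, div_one, one_smul, blk_one,
    toSite_zero, add_zero]

/-- [folklore] **NESTED MEANS**: the `L^m`-block mean (on the coarse lattice) of the `L`-block mean, read through the block label, is the `L^(m+1)`-block mean:
`(blockMeanAt (L^m) (bmean L f)) ∘ blk L = blockMeanAt (L^(m+1)) f` (`L ≥ 1`; gan24-leaf-04's `blockSum_mul`). -/
theorem liftBlk_blockMeanAt_bmean {L : ℕ} (hL : 1 ≤ L) (m : ℕ) (f : Form0 d ℝ) :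
    liftBlk L (blockMeanAt (L ^ m) (bmean L f)) = blockMeanAt (L ^ (m + 1)) f := by
  funext x
  have hL0 : (L : ℝ) ≠ 0 := by exact_mod_cast (show L ≠ 0 by omega)
  have hnest : ∀ Y : Site d, blockSum (L ^ m) (bmean L f) Y = (((L : ℝ) ^ d))⁻¹ * blockSum (L ^ (m + 1)) f Y := by
    intro Y
    rw [pow_succ', blockSum_mul hL (L ^ m) f Y]
    simp only [bmean, AffineAveraging.blockSum, Finset.mul_sum]
  simp only [liftBlk, blockMeanAt]
  rw [blk_blk', ← pow_succ', hnest]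
  push_cast
  field_simp
  ring

/-! ## §2 One-step letters of the literal's functional `σ₁ = symBmGaugeAt ρ · Lc` (the exact-form identities are the owner's `FP/BlockMeanProjectorGrad`) -/

/-- [folklore] **THE FINE GAUGE DIRECTIONS ARE `𝒬̄`-BLIND**: `𝒬̄_L (grad θ) = 0` for `θ` of zero `L`-block sums (the abstract `Q₁W₁ = 0` of
`NestedDressingStepLaw`, at the lattice). -/
theorem qbar_grad_eq_zero_of_blockSum (L : ℕ) {θ : Form0 d ℝ} (hθ : blockSum L θ = 0) : qbar L (grad θ) = 0 := by
  rw [qbar_grad]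
  have h : bmean L θ = 0 := by funext y; simp [bmean, hθ]
  rw [h, grad_zero]

/-- [folklore] **`σ₁ ∘ dz = id` ON THE FINE GAUGE PARAMETERS** `Θ_L` (zero `L`-block sums): the abstract `S₁W₁` invertible — here the identity (owner's
`symBmGaugeAt_grad`). -/
theorem symBmGaugeAt_grad_of_blockSum {L : ℕ} (hL : 1 ≤ L) (ρ : Site d) {θ : Form0 d ℝ} (hθ : blockSum L θ = 0) :
    symBmGaugeAt ρ (grad θ) L = θ := by
  rw [symBmGaugeAt_grad hL]
  have h : blockMeanAt L θ = 0 := by funext x; simp [blockMeanAt, hθ]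
  rw [h, sub_zero]

/-- [folklore] Linearity of `σ₁` (differences). -/
theorem symBmGaugeAt_sub (ρ : Site d) (A A' : Form1 d ℝ) (L : ℕ) :
    symBmGaugeAt ρ (A - A') L = symBmGaugeAt ρ A L - symBmGaugeAt ρ A' L := by
  have hg : symGaugeAt ρ (A - A') L = symGaugeAt ρ A L - symGaugeAt ρ A' L := by
    funext x; simp only [symGaugeAt, Pi.sub_apply, symTreeGaugeAt_sub, mul_sub]
  unfold symBmGaugeAt
  rw [hg, blockMeanAt_sub]
  abel

/-- [folklore] `σ₁ 0 = 0`. -/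
theorem symBmGaugeAt_zero (ρ : Site d) (L : ℕ) : symBmGaugeAt ρ (0 : Form1 d ℝ) L = 0 := by
  have h := symBmGaugeAt_sub ρ (0 : Form1 d ℝ) 0 L
  rwa [sub_self, sub_self] at h

/-- [folklore] `σ₁ A` has zero `L`-block sums (`L ≥ 1`; an2's `blockSum_sub_blockMeanAt`). -/
theorem blockSum_symBmGaugeAt {L : ℕ} (hL : 1 ≤ L) (ρ : Site d) (A : Form1 d ℝ) : blockSum L (symBmGaugeAt ρ A L) = 0 :=
  blockSum_sub_blockMeanAt hL _

/-- [folklore] … hence zero coarse block means. -/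
theorem bmean_symBmGaugeAt {L : ℕ} (hL : 1 ≤ L) (ρ : Site d) (A : Form1 d ℝ) : bmean L (symBmGaugeAt ρ A L) = 0 := by
  funext y
  rw [bmean, blockSum_symBmGaugeAt hL]
  simp

/-! ## §3 The nested dressing functional `σ^{(m)}` and the nested projector `Π^{(m)}_nest` -/

/-- [our object] **THE NESTED SYMMETRISED BLOCK-MEAN GAUGE FUNCTIONAL** of the `m`-fold composite step at blocking `Lc` per step: `σ^{(0)} := 0`,
`σ^{(m+1)} A := σ₁ A + (σ^{(m)} (𝒬̄_{Lc} A)) ∘ blk Lc` — each level's own block-mean-normalised symmetrised gauge of its own averaged variable, read on the fine lattice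
through the block label. -/
def symNestGaugeAt (ρ : Site d) (Lc : ℕ) : ℕ → Form1 d ℝ → Form0 d ℝ
  | 0 => fun _ => 0
  | m + 1 => fun A => symBmGaugeAt ρ A Lc + liftBlk Lc (symNestGaugeAt ρ Lc m (qbar Lc A))

/-- [our object] **THE NESTED PROJECTOR** `Π^{(m)}_nest A := A − grad (σ^{(m)} A)`. -/
def symAxProjNestAt (ρ : Site d) (Lc m : ℕ) (A : Form1 d ℝ) : Form1 d ℝ := A - grad (symNestGaugeAt ρ Lc m A)

/-- [folklore] `σ^{(0)} = 0`. -/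
theorem symNestGaugeAt_zero_left (ρ : Site d) (Lc : ℕ) (A : Form1 d ℝ) : symNestGaugeAt ρ Lc 0 A = 0 := rfl

/-- [folklore] The recursion. -/
theorem symNestGaugeAt_succ (ρ : Site d) (Lc m : ℕ) (A : Form1 d ℝ) :
    symNestGaugeAt ρ Lc (m + 1) A = symBmGaugeAt ρ A Lc + liftBlk Lc (symNestGaugeAt ρ Lc m (qbar Lc A)) := rfl

/-- [folklore] **`σ^{(1)} = σ₁`**: at `m = 1` the nested functional is the literal's own. -/
theorem symNestGaugeAt_one (ρ : Site d) (Lc : ℕ) (A : Form1 d ℝ) : symNestGaugeAt ρ Lc 1 A = symBmGaugeAt ρ A Lc := by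
  rw [symNestGaugeAt_succ, symNestGaugeAt_zero_left, liftBlk_zero, add_zero]

/-- [folklore] `Π^{(0)}_nest = id` (no dressing). -/
theorem symAxProjNestAt_zero (ρ : Site d) (Lc : ℕ) (A : Form1 d ℝ) : symAxProjNestAt ρ Lc 0 A = A := by
  rw [symAxProjNestAt, symNestGaugeAt_zero_left, grad_zero, sub_zero]

/-- [folklore] **`Π^{(1)}_nest = Π^{sym}_bm`**: THE LITERAL IS UNCHANGED AT `m = 1` (so the one-step rows `hSt1`∕`hWt1` of the road stand as typed). -/
theorem symAxProjNestAt_one (ρ : Site d) (Lc : ℕ) : symAxProjNestAt ρ Lc 1 = symAxProjBmAt ρ Lc := by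
  funext A
  rw [symAxProjNestAt, symNestGaugeAt_one]
  rfl

/-- [folklore] `σ^{(m)} 0 = 0`. -/
theorem symNestGaugeAt_map_zero (ρ : Site d) (Lc : ℕ) : ∀ m : ℕ, symNestGaugeAt ρ Lc m (0 : Form1 d ℝ) = 0
  | 0 => rfl
  | m + 1 => by
      rw [symNestGaugeAt_succ, qbar_zero, symNestGaugeAt_map_zero ρ Lc m, symBmGaugeAt_zero, liftBlk_zero, add_zero]

/-- [folklore] Linearity of `σ^{(m)}` (differences). -/
theorem symNestGaugeAt_sub (ρ : Site d) (Lc : ℕ) : ∀ (m : ℕ) (A A' : Form1 d ℝ),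
    symNestGaugeAt ρ Lc m (A - A') = symNestGaugeAt ρ Lc m A - symNestGaugeAt ρ Lc m A'
  | 0, A, A' => by simp [symNestGaugeAt_zero_left]
  | m + 1, A, A' => by
      rw [symNestGaugeAt_succ, symNestGaugeAt_succ, symNestGaugeAt_succ, qbar_sub, symNestGaugeAt_sub ρ Lc m, symBmGaugeAt_sub,
        liftBlk_sub]
      abel

/-- [folklore] Linearity of `Π^{(m)}_nest` (differences). -/
theorem symAxProjNestAt_sub (ρ : Site d) (Lc m : ℕ) (A A' : Form1 d ℝ) :
    symAxProjNestAt ρ Lc m (A - A') = symAxProjNestAt ρ Lc m A - symAxProjNestAt ρ Lc m A' := by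
  simp only [symAxProjNestAt, symNestGaugeAt_sub, grad_sub]
  abel

/-- [folklore] **THE CLOSED FORM**: `σ^{(m)} A x = Σ_{k<m} σ₁ (𝒬̄^k A) (blk (Lc^k) x)` — the sum over the levels of each level's own one-step gauge of its own averaged
variable, read through that level's block label. -/
theorem symNestGaugeAt_eq_sum (ρ : Site d) (Lc : ℕ) : ∀ (m : ℕ) (A : Form1 d ℝ) (x : Site d),
    symNestGaugeAt ρ Lc m A x = ∑ k ∈ Finset.range m, symBmGaugeAt ρ ((qbar Lc)^[k] A) Lc (blk (Lc ^ k) x)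
  | 0, A, x => by simp [symNestGaugeAt_zero_left]
  | m + 1, A, x => by
      rw [symNestGaugeAt_succ, Pi.add_apply, liftBlk, symNestGaugeAt_eq_sum ρ Lc m (qbar Lc A) (blk Lc x), Finset.sum_range_succ']
      simp only [Function.iterate_succ_apply, blk_blk', ← pow_succ', Function.iterate_zero_apply, pow_zero, blk_one]
      rw [add_comm]

/-! ## §4 Exact forms: `σ^{(m)}` reads a gradient modulo its `Lc^m`-block means; `Π^{(m)}_nest` kills `dz Θ_{Lc^m}` -/

/-- [folklore] **THE NESTED FUNCTIONAL ON EXACT FORMS**: `σ^{(m)} (grad f) = f − blockMeanAt (Lc^m) f` (`Lc ≥ 1`, every `m`, every root). -/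
theorem symNestGaugeAt_grad {Lc : ℕ} (hLc : 1 ≤ Lc) (ρ : Site d) : ∀ (m : ℕ) (f : Form0 d ℝ),
    symNestGaugeAt ρ Lc m (grad f) = f - blockMeanAt (Lc ^ m) f
  | 0, f => by rw [symNestGaugeAt_zero_left, pow_zero, blockMeanAt_one, sub_self]
  | m + 1, f => by
      rw [symNestGaugeAt_succ, symBmGaugeAt_grad hLc, qbar_grad, symNestGaugeAt_grad hLc ρ m, liftBlk_sub, liftBlk_bmean,
        liftBlk_blockMeanAt_bmean hLc]
      abel

/-- [folklore] **THE NESTED PROJECTOR ON EXACT FORMS**: `Π^{(m)}_nest (grad f) = grad (blockMeanAt (Lc^m) f)`. -/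
theorem symAxProjNestAt_grad {Lc : ℕ} (hLc : 1 ≤ Lc) (ρ : Site d) (m : ℕ) (f : Form0 d ℝ) :
    symAxProjNestAt ρ Lc m (grad f) = grad (blockMeanAt (Lc ^ m) f) := by
  rw [symAxProjNestAt, symNestGaugeAt_grad hLc, grad_sub]
  abel

/-- [folklore] **`σ^{(m)} ∘ dz = id` ON THE COMPOSITE GAUGE PARAMETERS** `Θ_{Lc^m}` (zero `Lc^m`-block sums): the nested coordinates in which the abstract
`(τ̃·dz|_Θ)⁻¹ τ̃` of `NestedDressingStepLaw` is written. -/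
theorem symNestGaugeAt_grad_of_blockSum {Lc : ℕ} (hLc : 1 ≤ Lc) (ρ : Site d) (m : ℕ) {θ : Form0 d ℝ} (hθ : blockSum (Lc ^ m) θ = 0) :
    symNestGaugeAt ρ Lc m (grad θ) = θ := by
  rw [symNestGaugeAt_grad hLc]
  have h : blockMeanAt (Lc ^ m) θ = 0 := by funext x; simp [blockMeanAt, hθ]
  rw [h, sub_zero]

/-- [folklore] **`Π^{(m)}_nest` KILLS EVERY COMPOSITE GAUGE DIRECTION**: `grad θ` with `θ` of zero `Lc^m`-block sums is annihilated (memo §9 (9d) (1):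
background-independent null directions `dz Θ_{Lc^m}`). -/
theorem symAxProjNestAt_grad_eq_zero_of_blockSum {Lc : ℕ} (hLc : 1 ≤ Lc) (ρ : Site d) (m : ℕ) {θ : Form0 d ℝ}
    (hθ : blockSum (Lc ^ m) θ = 0) : symAxProjNestAt ρ Lc m (grad θ) = 0 := by
  rw [symAxProjNestAt_grad hLc]
  have h : blockMeanAt (Lc ^ m) θ = 0 := by
    funext x; simp [blockMeanAt, hθ]
  rw [h, grad_zero]

/-- [folklore] … and FIXES the `Lc^m`-block-constant gauge directions: `Π^{(m)}_nest (grad (ψ ∘ blk (Lc^m))) = grad (ψ ∘ blk (Lc^m))`. -/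
theorem symAxProjNestAt_grad_liftBlk {Lc : ℕ} (hLc : 1 ≤ Lc) (ρ : Site d) (m : ℕ) (ψ : Form0 d ℝ) :
    symAxProjNestAt ρ Lc m (grad (liftBlk (Lc ^ m) ψ)) = grad (liftBlk (Lc ^ m) ψ) := by
  rw [symAxProjNestAt_grad hLc, blockMeanAt_liftBlk (Nat.one_le_pow _ _ hLc)]

/-! ## §5 Zero block sums of the nested gauge; idempotency; the composite straight averages are preserved -/

/-- [folklore] **`σ^{(m)} A` HAS ZERO `Lc^m`-BLOCK SUMS** (`Lc ≥ 1`): level by level, `σ₁` has zero `Lc`-block sums and a lifted function of zero `Lc^m`-block sums has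
zero `Lc^(m+1)`-block sums (`blockSum_comp_blk_mul`). -/
theorem blockSum_symNestGaugeAt {Lc : ℕ} (hLc : 1 ≤ Lc) (ρ : Site d) : ∀ (m : ℕ) (A : Form1 d ℝ),
    blockSum (Lc ^ m) (symNestGaugeAt ρ Lc m A) = 0
  | 0, A => by funext y; simp [symNestGaugeAt_zero_left, AffineAveraging.blockSum]
  | m + 1, A => by
      funext Y
      have hadd : blockSum (Lc ^ (m + 1)) (symNestGaugeAt ρ Lc (m + 1) A) Y
          = blockSum (Lc ^ (m + 1)) (symBmGaugeAt ρ A Lc) Y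
            + blockSum (Lc ^ (m + 1)) (liftBlk Lc (symNestGaugeAt ρ Lc m (qbar Lc A))) Y := by
        simp only [symNestGaugeAt_succ, AffineAveraging.blockSum, Pi.add_apply, Finset.sum_add_distrib]
      have h1 : blockSum (Lc ^ (m + 1)) (symBmGaugeAt ρ A Lc) Y = 0 := by
        rw [pow_succ', blockSum_mul hLc (Lc ^ m)]
        refine Finset.sum_eq_zero fun c _ => ?_
        rw [blockSum_symBmGaugeAt hLc]
        rfl
      have h2 : blockSum (Lc ^ (m + 1)) (liftBlk Lc (symNestGaugeAt ρ Lc m (qbar Lc A))) Y = 0 := by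
        have h := blockSum_comp_blk_mul hLc (Lc ^ m) (symNestGaugeAt ρ Lc m (qbar Lc A)) Y
        rw [blockSum_symNestGaugeAt hLc ρ m (qbar Lc A), Pi.zero_apply, mul_zero, ← pow_succ'] at h
        exact h
      rw [hadd, h1, h2, add_zero]
      rfl

/-- [folklore] … hence `blockMeanAt (Lc^m) (σ^{(m)} A) = 0`. -/
theorem blockMeanAt_symNestGaugeAt {Lc : ℕ} (hLc : 1 ≤ Lc) (ρ : Site d) (m : ℕ) (A : Form1 d ℝ) :
    blockMeanAt (Lc ^ m) (symNestGaugeAt ρ Lc m A) = 0 := by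
  funext x
  simp [blockMeanAt, blockSum_symNestGaugeAt hLc]

/-- [folklore] **`σ^{(m)} ∘ Π^{(m)}_nest = 0`**: the projected field is in the nested slice. -/
theorem symNestGaugeAt_symAxProjNestAt {Lc : ℕ} (hLc : 1 ≤ Lc) (ρ : Site d) (m : ℕ) (A : Form1 d ℝ) :
    symNestGaugeAt ρ Lc m (symAxProjNestAt ρ Lc m A) = 0 := by
  rw [symAxProjNestAt, symNestGaugeAt_sub, symNestGaugeAt_grad hLc, blockMeanAt_symNestGaugeAt hLc]
  simp

/-- [folklore] **`Π^{(m)}_nest` IS IDEMPOTENT** (`Lc ≥ 1`, every root). -/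
theorem symAxProjNestAt_idem {Lc : ℕ} (hLc : 1 ≤ Lc) (ρ : Site d) (m : ℕ) (A : Form1 d ℝ) :
    symAxProjNestAt ρ Lc m (symAxProjNestAt ρ Lc m A) = symAxProjNestAt ρ Lc m A := by
  show symAxProjNestAt ρ Lc m A - grad (symNestGaugeAt ρ Lc m (symAxProjNestAt ρ Lc m A)) = _
  rw [symNestGaugeAt_symAxProjNestAt hLc, grad_zero, sub_zero]

/-- [folklore] **THE COMPOSITE STRAIGHT AVERAGES ARE PRESERVED**: `contourSum (Lc^m) (Π^{(m)}_nest A) = contourSum (Lc^m) A` (`Lc ≥ 1`) — the `m`-fold twin of an2's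
`contourSum_symAxProjBmAt`: the nested dressing is invisible to the `m`-fold straight averaging constraint. -/
theorem contourSum_symAxProjNestAt {Lc : ℕ} (hLc : 1 ≤ Lc) (ρ : Site d) (m : ℕ) (A : Form1 d ℝ) :
    contourSum (Lc ^ m) (symAxProjNestAt ρ Lc m A) = contourSum (Lc ^ m) A := by
  rw [symAxProjNestAt, contourSum_sub, grad_eq_dz, contourSum_dz, blockSum_symNestGaugeAt hLc]
  have h0 : dz (0 : Form0 d ℝ) = 0 := by funext κ x; simp [dz]
  rw [h0, sub_zero]

/-! ## §6 On `ker 𝒬_{Lc}` the nested projector is the literal's one-step projector; descent through one averaging -/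

/-- [folklore] **ON `ker 𝒬̄_{Lc}` THE NESTED PROJECTOR IS `Π̂₁`** — the lattice twin of the owner's `NestedDressingStepLaw.nestedProj_mul_of_blind`
(memo §9 (9d) (2): the fine step of the nested system is the literal's own). -/
theorem symAxProjNestAt_succ_of_qbar_eq_zero (ρ : Site d) (Lc m : ℕ) {A : Form1 d ℝ} (hA : qbar Lc A = 0) :
    symAxProjNestAt ρ Lc (m + 1) A = symAxProjBmAt ρ Lc A := by
  rw [symAxProjNestAt, symNestGaugeAt_succ, hA, symNestGaugeAt_map_zero, liftBlk_zero, add_zero]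
  rfl

/-- [folklore] The same with the hypothesis on the un-normalised straight averages `contourSum Lc A = 0`. -/
theorem symAxProjNestAt_succ_of_contourSum_eq_zero (ρ : Site d) (Lc m : ℕ) {A : Form1 d ℝ} (hA : contourSum Lc A = 0) :
    symAxProjNestAt ρ Lc (m + 1) A = symAxProjBmAt ρ Lc A := by
  refine symAxProjNestAt_succ_of_qbar_eq_zero ρ Lc m ?_
  funext κ y
  simp [qbar, hA]

/-- [folklore] **DESCENT THROUGH ONE AVERAGING**: `𝒬̄_{Lc} (Π^{(m+1)}_nest A) = Π^{(m)}_nest (𝒬̄_{Lc} A)` (`Lc ≥ 1`) — the averaged nested-dressed field is the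
nested-dressed averaged field one level down (the Form-level shadow of the coarse dictionary (β-c)). -/
theorem qbar_symAxProjNestAt_succ {Lc : ℕ} (hLc : 1 ≤ Lc) (ρ : Site d) (m : ℕ) (A : Form1 d ℝ) :
    qbar Lc (symAxProjNestAt ρ Lc (m + 1) A) = symAxProjNestAt ρ Lc m (qbar Lc A) := by
  rw [symAxProjNestAt, symAxProjNestAt, qbar_sub, symNestGaugeAt_succ, grad_add, qbar_add, qbar_grad, qbar_grad, bmean_symBmGaugeAt hLc,
    bmean_liftBlk hLc, grad_zero, zero_add]

/-- [folklore] **ITERATED DESCENT**: `𝒬̄^k (Π^{(m+k)}_nest A) = Π^{(m)}_nest (𝒬̄^k A)`. -/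
theorem qbar_iterate_symAxProjNestAt {Lc : ℕ} (hLc : 1 ≤ Lc) (ρ : Site d) (m : ℕ) : ∀ (k : ℕ) (A : Form1 d ℝ),
    (qbar Lc)^[k] (symAxProjNestAt ρ Lc (m + k) A) = symAxProjNestAt ρ Lc m ((qbar Lc)^[k] A)
  | 0, A => rfl
  | k + 1, A => by
      rw [Function.iterate_succ_apply, Function.iterate_succ_apply, ← add_assoc, qbar_symAxProjNestAt_succ hLc,
        qbar_iterate_symAxProjNestAt hLc ρ m k]

end

end Summit.QuantumFields.BalabanUV.Beta.FP.NestedDressingProjector
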